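/-
Copyright (c) 2026 The decomp-a2c cell. All rights reserved.
Released under Apache 2.0 license as described in the file LICENSE.
-/
import Summits.AtomisticToContinuum.Crystallization.Theorems.ChartedZeroExcessLayeredLatticeLiouvilleWP

/-!
# ChartedZeroExcessLayeredLatticeLiouville — part WQ «SlopeMismatch»: the kernel-weighted bound of the column planar flux and the ϱ-FREE
  slope-mismatch estimate `‖colPlanar T φ γ₀ m − boxSlope (slopeAt φ x₀) m‖ ≤ 216·K·δ₁·(|m − α₀| + 1)` on the central column
  (decomp-a2c-lens-2, g58; helper of stmt-AtomisticToContinuum-26636, leaf (PC) `ProfileComparisonAt`; step (WP/WQ) of memo NODE-g58d §3–4)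

* `idxWt_mul_cube_eq`, `sum_idxWt_mul_cube_le` — the third kernel moment `Σ_Y idxWt(Y − X)·N(Y − X)³ = Σ N⁻⁵ ≤ 54` (UY `sum_idxWeight_shift_le`);
* ★ `norm_colPlanar_le_weighted` — part WG's exchange-and-count bound of the column planar flux with an OFFSET-WEIGHTED hypothesis: if the in-plane
  unit differences on the walk sites of a bond of offset norm `M` are `≤ G₀ + G₁·M`, then `‖colPlanar T ψ γ m‖ ≤ 108·K·(G₀ + G₁)` (moments
  `Σ idxWt·N² ≤ 54` and `Σ idxWt·N³ ≤ 54`; uniform in `ϱ` and `T`, no harmonicity);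
* ★★ `norm_colPlanar_drift_le` — for `φ` truncated-harmonic on `idxBall x₀ n`, `n ≥ 512(ϱ/c + 2)` and `|m − α₀| + 2⌊ϱ/c⌋₊ ≤ n/2`:
  `‖colPlanar T (φ − A) x₀.1 m‖ ≤ 216·kernelConst·δ₁·(|m − α₀| + 1)`, `δ₁ = √(864·ipConst·E/(n²·#idxBall x₀ n))`,
  `A = modeField (slopeAt φ x₀) 0`
  — with part WP `colPlanar_sub_boxSlope` this is the slope-mismatch term of the flux drift `h(m)` with a `ϱ`-FREE constant (critic row 1007 (ii));
  the walk sites of a bond `(γ₀,α) → (γ₀+d, α+t)` across the cut at `m` lie at index distance `≤ |m − α₀| + 2N(d,t)` from `x₀` (part WP's pointwise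
  slope drift `δ₁·dist`), which is what replaces WG's uniform sup.
-/

namespace Summit.AtomisticToContinuum.Crystallization.Theorems.ChartedZeroExcessLayeredLatticeLiouville

open Summit.AtomisticToContinuum.Crystallization.Theorems.ChartedPlanarOrderRigidityDoor (E3)
open Finset
open scoped InnerProductSpace RealInnerProductSpace BigOperators

noncomputable section SlopeMismatch

variable {c : ℝ} {a b : E3} {w : ℤ → E3}

/-! ### WQ.1  The third kernel moment -/

/-- `idxWt·N³ = N⁻⁵ = N⁻⁷·N²` (both sides vanish at `N = 0`). [formal bookkeeping] -/
theorem idxWt_mul_cube_eq (v : Cell 2 × ℤ) : idxWt v * (idxNorm v : ℝ) ^ 3 = (((idxNorm v : ℝ)) ^ 7)⁻¹ * (idxNorm v : ℝ) ^ 2 := by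
  rcases Nat.eq_zero_or_pos (idxNorm v) with h0 | hpos
  · simp [idxWt, h0]
  · have hN : (idxNorm v : ℝ) ≠ 0 := by positivity
    unfold idxWt
    rw [inv_pow]
    field_simp

/-- the third kernel moment about any centre: `Σ_{Y ∈ V} idxWt(Y − X)·N(Y − X)³ ≤ 54`. [this file, g58] -/
theorem sum_idxWt_mul_cube_le (V : Finset (Cell 2 × ℤ)) (X : Cell 2 × ℤ) :
    ∑ Y ∈ V, idxWt (Y - X) * (idxNorm (Y - X) : ℝ) ^ 3 ≤ 54 :=
  (sum_le_sum fun Y _ => (idxWt_mul_cube_eq (Y - X)).le).trans (sum_idxWeight_shift_le V X)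

/-! ### WQ.2  The column planar flux under an offset-weighted hypothesis -/

/-- ★ THE PLANAR PART OF THE COLUMN FLUX, OFFSET-WEIGHTED: if for every `M ≤ ⌊ϱ/c⌋` the in-plane unit differences of `ψ` on the coordinate box of
half-width `M` about `γ` in the layers `(m, m + M]` are bounded by `G₀ + G₁·M`, then `‖colPlanar T ψ γ m‖ ≤ 108·F·(G₀ + G₁)` — part WG's proof
with the bond of offset `v` weighted by `idxWt(v)·N(v)·(G₀ + G₁·N(v))`, the cut crossed by `≤ N(v)` translates of each offset, and the two moments
`Σ idxWt·N² ≤ 54` (WD), `Σ idxWt·N³ ≤ 54` (WQ.1); uniform in `ϱ` and `T`, no harmonicity. [this file, g58] -/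
theorem norm_colPlanar_le_weighted (hc : 0 < c) (hL : IsLayeredCrystal c a b w) {ϱ : ℝ} (ψ : Cell 2 → ℤ → E3) (T : Finset ℤ) (γ : Cell 2)
    (m : ℤ) {G₀ G₁ : ℝ} (hG0 : 0 ≤ G₀) (hG1 : 0 ≤ G₁)
    (hG : ∀ (p : Cell 2) (β : ℤ) (M : ℕ), (∀ j, |p j - γ j| ≤ (M : ℤ)) → m < β → β ≤ m + M → M ≤ ⌊ϱ / c⌋₊ →
      ‖latDiff idxAxis₁ ψ p β‖ ≤ G₀ + G₁ * M ∧ ‖latDiff idxAxis₂ ψ p β‖ ≤ G₀ + G₁ * M) :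
    ‖colPlanar ϱ a b w T ψ γ m‖ ≤ 108 * kernelConst c * (G₀ + G₁) := by
  have hF := kernelConst_nonneg hc
  have hω0 : ∀ v : Cell 2 × ℤ, 0 ≤ idxWt v * (idxNorm v : ℝ) * (G₀ + G₁ * idxNorm v) := fun v => by
    have := idxWt_nonneg v
    positivity
  -- the planar flux across the cut, bond by bond
  have hpf : ∀ α ∈ T.filter (· ≤ m), ∀ β ∈ T.filter (m < ·), ‖planarFlux ϱ a b w ψ (γ, α) β‖ ≤ 2 * kernelConst c *
      ∑ Y ∈ (finite_near_lsite hc hL (γ, α) ϱ).toFinset with Y.2 = β,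
        idxWt (Y - (γ, α)) * (idxNorm (Y - (γ, α)) : ℝ) * (G₀ + G₁ * idxNorm (Y - (γ, α))) := by
    intro α hα β hβ
    have hαm : α ≤ m := (mem_filter.mp hα).2
    have hmβ : m < β := (mem_filter.mp hβ).2
    have hsum : ∑ Y ∈ (finite_near_lsite hc hL (γ, α) ϱ).toFinset with Y.2 = β, idxWt (Y - (γ, α)) * ‖ψ Y.1 Y.2 - ψ (γ, α).1 Y.2‖ ≤
        ∑ Y ∈ (finite_near_lsite hc hL (γ, α) ϱ).toFinset with Y.2 = β,
          2 * (idxWt (Y - (γ, α)) * (idxNorm (Y - (γ, α)) : ℝ) * (G₀ + G₁ * idxNorm (Y - (γ, α)))) := by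
      refine sum_le_sum fun Y hY => ?_
      obtain ⟨hYn, hYβ⟩ := mem_filter.mp hY
      have hnear := idxNorm_le_of_near hc hL ((finite_near_lsite hc hL (γ, α) ϱ).mem_toFinset.mp hYn)
      obtain ⟨⟨d, t⟩, rfl⟩ : ∃ v : Cell 2 × ℤ, Y = (γ + v.1, α + v.2) := ⟨Y - (γ, α), Prod.ext (by simp) (by simp)⟩
      dsimp only at hnear hYβ ⊢
      have hv : (γ + d, α + t) - (γ, α) = (d, t) := Prod.ext (add_sub_cancel_left _ _) (add_sub_cancel_left _ _)
      rw [hv] at hnear ⊢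
      have hM : ∀ j, |d j| ≤ ((idxNorm (d, t) : ℕ) : ℤ) := fun j => by
        have h := natAbs_fst_le_idxNorm (d, t) j
        dsimp only at h
        rw [Int.abs_eq_natAbs]
        exact_mod_cast h
      have ht : t ≤ ((idxNorm (d, t) : ℕ) : ℤ) := by
        have h := natAbs_snd_le_idxNorm (d, t)
        dsimp only at h
        omega
      have hbox := norm_sub_le_of_box (fun p => ψ p (α + t)) γ d hM (G := G₀ + G₁ * idxNorm (d, t)) fun p hp => by
        have h := hG p (α + t) (idxNorm (d, t)) hp (by omega) (by omega) hnear
        rw [latDiff_axis₁_apply, latDiff_axis₂_apply] at h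
        exact h
      have h2 : ((((d 0).natAbs + (d 1).natAbs : ℕ)) : ℝ) ≤ 2 * idxNorm (d, t) := by
        have e0 : (((d 0).natAbs : ℕ) : ℝ) ≤ idxNorm (d, t) := by exact_mod_cast natAbs_fst_le_idxNorm (d, t) 0
        have e1 : (((d 1).natAbs : ℕ) : ℝ) ≤ idxNorm (d, t) := by exact_mod_cast natAbs_fst_le_idxNorm (d, t) 1
        push_cast
        linarith
      have hw := idxWt_nonneg (d, t)
      have hGM : 0 ≤ G₀ + G₁ * idxNorm (d, t) := by positivity
      calc idxWt (d, t) * ‖ψ (γ + d) (α + t) - ψ γ (α + t)‖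
          ≤ idxWt (d, t) * (((((d 0).natAbs + (d 1).natAbs : ℕ)) : ℝ) * (G₀ + G₁ * idxNorm (d, t))) := mul_le_mul_of_nonneg_left hbox hw
        _ ≤ idxWt (d, t) * (2 * (idxNorm (d, t) : ℝ) * (G₀ + G₁ * idxNorm (d, t))) :=
            mul_le_mul_of_nonneg_left (mul_le_mul_of_nonneg_right h2 hGM) hw
        _ = 2 * (idxWt (d, t) * (idxNorm (d, t) : ℝ) * (G₀ + G₁ * idxNorm (d, t))) := by ring
    calc ‖planarFlux ϱ a b w ψ (γ, α) β‖
        ≤ kernelConst c * ∑ Y ∈ (finite_near_lsite hc hL (γ, α) ϱ).toFinset with Y.2 = β, idxWt (Y - (γ, α)) * ‖ψ Y.1 Y.2 - ψ (γ, α).1 Y.2‖ :=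
          norm_planarFlux_le hc hL ϱ ψ (γ, α) β
      _ ≤ kernelConst c * ∑ Y ∈ (finite_near_lsite hc hL (γ, α) ϱ).toFinset with Y.2 = β,
            2 * (idxWt (Y - (γ, α)) * (idxNorm (Y - (γ, α)) : ℝ) * (G₀ + G₁ * idxNorm (Y - (γ, α)))) :=
          mul_le_mul_of_nonneg_left hsum hF
      _ = _ := by rw [← mul_sum]; ring
  -- collapsing the fibres and passing to offsets
  have hinner : ∀ α ∈ T.filter (· ≤ m),
      ∑ β ∈ T.filter (m < ·), ∑ Y ∈ (finite_near_lsite hc hL (γ, α) ϱ).toFinset with Y.2 = β,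
          idxWt (Y - (γ, α)) * (idxNorm (Y - (γ, α)) : ℝ) * (G₀ + G₁ * idxNorm (Y - (γ, α))) ≤
        ∑ v ∈ (idxBox ⌊ϱ / c⌋₊).filter (fun v => m - α < v.2), idxWt v * (idxNorm v : ℝ) * (G₀ + G₁ * idxNorm v) := by
    intro α _
    rw [sum_fiberwise_eq_sum_filter]
    refine sum_le_sum_of_injOn' (· - (γ, α)) (fun _ _ _ _ h => sub_left_injective h) (fun Y hY => ?_) (fun v _ => hω0 v) fun _ _ => le_rfl
    obtain ⟨hYn, hYβ⟩ := mem_filter.mp hY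
    refine mem_filter.mpr ⟨mem_idxBox (idxNorm_le_of_near hc hL ((finite_near_lsite hc hL (γ, α) ϱ).mem_toFinset.mp hYn)), ?_⟩
    have hlt : m < Y.2 := (mem_filter.mp hYβ).2
    simp only [Prod.snd_sub]
    omega
  -- exchanging the sums and counting the cut layers per offset
  have hswap : ∑ α ∈ T.filter (· ≤ m), ∑ v ∈ (idxBox ⌊ϱ / c⌋₊).filter (fun v => m - α < v.2), idxWt v * (idxNorm v : ℝ) * (G₀ + G₁ * idxNorm v) =
      ∑ v ∈ idxBox ⌊ϱ / c⌋₊, (#({α ∈ T.filter (· ≤ m) | m - α < v.2}) : ℝ) * (idxWt v * (idxNorm v : ℝ) * (G₀ + G₁ * idxNorm v)) := by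
    rw [sum_comm' (t' := idxBox ⌊ϱ / c⌋₊) (s' := fun v => {α ∈ T.filter (· ≤ m) | m - α < v.2})]
    · exact sum_congr rfl fun v _ => by rw [sum_const, nsmul_eq_mul]
    · intro α v
      simp only [mem_filter]
      tauto
  have h54 : ∑ v ∈ idxBox ⌊ϱ / c⌋₊, idxWt v * (idxNorm v : ℝ) ^ 2 ≤ 54 := by
    simpa only [sub_zero] using sum_idxWt_mul_sq_le (idxBox ⌊ϱ / c⌋₊) 0
  have h54' : ∑ v ∈ idxBox ⌊ϱ / c⌋₊, idxWt v * (idxNorm v : ℝ) ^ 3 ≤ 54 := by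
    simpa only [sub_zero] using sum_idxWt_mul_cube_le (idxBox ⌊ϱ / c⌋₊) 0
  have hcount : ∑ v ∈ idxBox ⌊ϱ / c⌋₊, (#({α ∈ T.filter (· ≤ m) | m - α < v.2}) : ℝ) * (idxWt v * (idxNorm v : ℝ) * (G₀ + G₁ * idxNorm v)) ≤
      54 * (G₀ + G₁) := by
    calc ∑ v ∈ idxBox ⌊ϱ / c⌋₊, (#({α ∈ T.filter (· ≤ m) | m - α < v.2}) : ℝ) * (idxWt v * (idxNorm v : ℝ) * (G₀ + G₁ * idxNorm v))
        ≤ ∑ v ∈ idxBox ⌊ϱ / c⌋₊, (idxNorm v : ℝ) * (idxWt v * (idxNorm v : ℝ) * (G₀ + G₁ * idxNorm v)) :=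
          sum_le_sum fun v _ => mul_le_mul_of_nonneg_right (count_cut_layers_le T m v) (hω0 v)
      _ = G₀ * ∑ v ∈ idxBox ⌊ϱ / c⌋₊, idxWt v * (idxNorm v : ℝ) ^ 2 + G₁ * ∑ v ∈ idxBox ⌊ϱ / c⌋₊, idxWt v * (idxNorm v : ℝ) ^ 3 := by
          rw [mul_sum, mul_sum, ← sum_add_distrib]
          exact sum_congr rfl fun v _ => by ring
      _ ≤ G₀ * 54 + G₁ * 54 := add_le_add (mul_le_mul_of_nonneg_left h54 hG0) (mul_le_mul_of_nonneg_left h54' hG1)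
      _ = 54 * (G₀ + G₁) := by ring
  -- assembling
  calc ‖colPlanar ϱ a b w T ψ γ m‖ = ‖∑ α ∈ T.filter (· ≤ m), ∑ β ∈ T.filter (m < ·), planarFlux ϱ a b w ψ (γ, α) β‖ := rfl
    _ ≤ ∑ α ∈ T.filter (· ≤ m), ∑ β ∈ T.filter (m < ·), ‖planarFlux ϱ a b w ψ (γ, α) β‖ :=
        (norm_sum_le _ _).trans (sum_le_sum fun α _ => norm_sum_le _ _)
    _ ≤ ∑ α ∈ T.filter (· ≤ m), ∑ β ∈ T.filter (m < ·), 2 * kernelConst c *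
          ∑ Y ∈ (finite_near_lsite hc hL (γ, α) ϱ).toFinset with Y.2 = β,
            idxWt (Y - (γ, α)) * (idxNorm (Y - (γ, α)) : ℝ) * (G₀ + G₁ * idxNorm (Y - (γ, α))) :=
        sum_le_sum fun α hα => sum_le_sum fun β hβ => hpf α hα β hβ
    _ = 2 * kernelConst c * ∑ α ∈ T.filter (· ≤ m), ∑ β ∈ T.filter (m < ·),
          ∑ Y ∈ (finite_near_lsite hc hL (γ, α) ϱ).toFinset with Y.2 = β,
            idxWt (Y - (γ, α)) * (idxNorm (Y - (γ, α)) : ℝ) * (G₀ + G₁ * idxNorm (Y - (γ, α))) := by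
        simp only [← mul_sum]
    _ ≤ 2 * kernelConst c * ∑ α ∈ T.filter (· ≤ m), ∑ v ∈ (idxBox ⌊ϱ / c⌋₊).filter (fun v => m - α < v.2),
          idxWt v * (idxNorm v : ℝ) * (G₀ + G₁ * idxNorm v) :=
        mul_le_mul_of_nonneg_left (sum_le_sum hinner) (by positivity)
    _ ≤ 2 * kernelConst c * (54 * (G₀ + G₁)) := by rw [hswap]; exact mul_le_mul_of_nonneg_left hcount (by positivity)
    _ = 108 * kernelConst c * (G₀ + G₁) := by ring

/-! ### WQ.3  The slope mismatch on the central column -/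

/-- walk sites of a bond across the cut at `m`: `|p_j − γ₀_j| ≤ M`, `m < β ≤ m + M` put `(p, β)` at index distance `≤ |m − α₀| + 2M` from `x₀ = (γ₀, α₀)`.
[formal bookkeeping] -/
theorem dist_walkSite_le (x₀ : Cell 2 × ℤ) {p : Cell 2} {β m : ℤ} {M : ℕ} (hp : ∀ j, |p j - x₀.1 j| ≤ (M : ℤ)) (hmβ : m < β)
    (hβ : β ≤ m + M) : dist ((p, β) : Cell 2 × ℤ) x₀ ≤ |((m - x₀.2 : ℤ) : ℝ)| + 2 * (M : ℝ) := by
  have h0 := hp 0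
  have h1 := hp 1
  rw [Int.abs_eq_natAbs] at h0 h1
  have e : ((p, β) : Cell 2 × ℤ) - x₀ = (p - x₀.1, β - x₀.2) := rfl
  have hN : idxNorm (((p, β) : Cell 2 × ℤ) - x₀) ≤ (m - x₀.2).natAbs + 2 * M := by
    rw [e]
    refine idxNorm_mk_le ?_ ?_ ?_
    · have : (p - x₀.1) 0 = p 0 - x₀.1 0 := rfl
      rw [this]; omega
    · have : (p - x₀.1) 1 = p 1 - x₀.1 1 := rfl
      rw [this]; omega
    · omega
  rw [dist_comm, dist_eq_idxNorm]
  have h := (Nat.cast_le (α := ℝ)).mpr hN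
  push_cast [Nat.cast_natAbs] at h ⊢
  exact h

/-- ★★ THE SLOPE MISMATCH, ϱ-FREE: for `φ` truncated-harmonic on `idxBall x₀ n` with `n ≥ 512(ϱ/c + 2)` and a cut layer `m` with
`|m − α₀| + 2⌊ϱ/c⌋₊ ≤ n/2`, the column planar flux of the slope-drift field `φ − A` on the central column satisfies
`‖colPlanar T (φ − A) x₀.1 m‖ ≤ 216·kernelConst·δ₁·(|m − α₀| + 1)`, `δ₁ = √(864·ipConst·E(φ; idxBall x₀ n)/(n²·#idxBall x₀ n))` — every
constant `ϱ`-free; by part WP `colPlanar_sub_boxSlope` the left side is `‖colPlanar T φ x₀.1 m − boxSlope ⌊ϱ/c⌋₊ (slopeAt φ x₀) m‖` for carriers `T` containing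
the band box. [this file, g58] -/
theorem norm_colPlanar_drift_le (hc : 0 < c) (hL : IsLayeredCrystal c a b w) {κ₀ ε ϱ : ℝ} (hκ₀ : 0 < κ₀) (hϱ : 0 ≤ ϱ) (hε : ε < 2 * κ₀)
    (hK : CoerciveZ (layeredKernel a b w) κ₀)
    (hT : ∀ φ : Cell 2 → ℤ → E3, HasFiniteSupport φ → Summable (tailFam ϱ a b w φ) ∧ ∑' x, tailFam ϱ a b w φ x ≤ ε * nnFormZ φ)
    (hP : ∀ E₀ : Cell 2 × ℤ, E₀.2 = 0 → (idxNorm E₀ : ℝ) ≤ 1 → ∀ (y₀ : Cell 2 × ℤ) (r' n' : ℝ), r' < n' → ∀ χ : Cell 2 → ℤ → E3,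
      IsTruncHarmonicZ ϱ a b w χ (idxBall y₀ (n' + 1)) →
        κ₀ * idxEnergy (latDiff E₀ χ) (idxBall y₀ r') ≤ 54 * kernelConst c * ((n' - r')⁻¹) ^ 2 * idxEnergy χ (idxBall y₀ (n' + ϱ / c + 1)))
    (x₀ : Cell 2 × ℤ) {n : ℝ} (hn : 512 * (ϱ / c + 2) ≤ n) {φ : Cell 2 → ℤ → E3} (hφ : IsTruncHarmonicZ ϱ a b w φ (idxBall x₀ n))
    (T : Finset ℤ) {m : ℤ} (hm : |((m - x₀.2 : ℤ) : ℝ)| + 2 * (⌊ϱ / c⌋₊ : ℝ) ≤ n / 2) :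
    ‖colPlanar ϱ a b w T (φ - modeField (slopeAt φ x₀) 0) x₀.1 m‖ ≤
      216 * kernelConst c * Real.sqrt (864 * ipConst c κ₀ ε * idxEnergy φ (idxBall x₀ n) / (n ^ 2 * ((idxBall x₀ n).ncard : ℝ))) *
        (|((m - x₀.2 : ℤ) : ℝ)| + 1) := by
  set δ₁ := Real.sqrt (864 * ipConst c κ₀ ε * idxEnergy φ (idxBall x₀ n) / (n ^ 2 * ((idxBall x₀ n).ncard : ℝ))) with hδ₁
  have hδ0 : 0 ≤ δ₁ := Real.sqrt_nonneg _
  have ha0 : 0 ≤ |((m - x₀.2 : ℤ) : ℝ)| := abs_nonneg _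
  have hF := kernelConst_nonneg hc
  have hG : ∀ (p : Cell 2) (β : ℤ) (M : ℕ), (∀ j, |p j - x₀.1 j| ≤ (M : ℤ)) → m < β → β ≤ m + M → M ≤ ⌊ϱ / c⌋₊ →
      ‖latDiff idxAxis₁ (φ - modeField (slopeAt φ x₀) 0) p β‖ ≤ δ₁ * |((m - x₀.2 : ℤ) : ℝ)| + 2 * δ₁ * M ∧
        ‖latDiff idxAxis₂ (φ - modeField (slopeAt φ x₀) 0) p β‖ ≤ δ₁ * |((m - x₀.2 : ℤ) : ℝ)| + 2 * δ₁ * M := by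
    intro p β M hp hmβ hβ hM
    have hd := dist_walkSite_le x₀ hp hmβ hβ
    have hMr : (M : ℝ) ≤ ⌊ϱ / c⌋₊ := by exact_mod_cast hM
    have hZ : ((p, β) : Cell 2 × ℤ) ∈ idxBall x₀ (n / 2) := show dist ((p, β) : Cell 2 × ℤ) x₀ ≤ n / 2 by linarith
    have h1 := norm_latDiff_sub_affine_le hc hL hκ₀ hϱ hε hK hT hP x₀ hn hφ idxAxis₁_snd idxNorm_idxAxis₁_le (sum_idxAxis₁_smul_slopeAt φ x₀) hZ
    have h2 := norm_latDiff_sub_affine_le hc hL hκ₀ hϱ hε hK hT hP x₀ hn hφ idxAxis₂_snd idxNorm_idxAxis₂_le (sum_idxAxis₂_smul_slopeAt φ x₀) hZ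
    rw [← hδ₁] at h1 h2
    have hb : δ₁ * dist ((p, β) : Cell 2 × ℤ) x₀ ≤ δ₁ * |((m - x₀.2 : ℤ) : ℝ)| + 2 * δ₁ * M := by
      have := mul_le_mul_of_nonneg_left hd hδ0
      linarith
    exact ⟨h1.trans hb, h2.trans hb⟩
  have h := norm_colPlanar_le_weighted hc hL (φ - modeField (slopeAt φ x₀) 0) T x₀.1 m (G₀ := δ₁ * |((m - x₀.2 : ℤ) : ℝ)|) (G₁ := 2 * δ₁)
    (by positivity) (by positivity) hG
  calc ‖colPlanar ϱ a b w T (φ - modeField (slopeAt φ x₀) 0) x₀.1 m‖ ≤ 108 * kernelConst c * (δ₁ * |((m - x₀.2 : ℤ) : ℝ)| + 2 * δ₁) := h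
    _ ≤ 216 * kernelConst c * δ₁ * (|((m - x₀.2 : ℤ) : ℝ)| + 1) := by nlinarith [mul_nonneg hF (mul_nonneg hδ0 ha0)]

/-- ★★ corollary, the mismatch itself: `‖colPlanar T φ x₀.1 m − boxSlope ⌊ϱ/c⌋₊ (slopeAt φ x₀) m‖ ≤ 216·K·δ₁·(|m − α₀| + 1)` for carriers `T`
containing the band box `[m − ⌊ϱ/c⌋₊, m + 1 + ⌊ϱ/c⌋₊]`. [this file, g58] -/
theorem norm_colPlanar_sub_boxSlope_le (hc : 0 < c) (hL : IsLayeredCrystal c a b w) {κ₀ ε ϱ : ℝ} (hκ₀ : 0 < κ₀) (hϱ : 0 ≤ ϱ) (hε : ε < 2 * κ₀)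
    (hK : CoerciveZ (layeredKernel a b w) κ₀)
    (hT : ∀ φ : Cell 2 → ℤ → E3, HasFiniteSupport φ → Summable (tailFam ϱ a b w φ) ∧ ∑' x, tailFam ϱ a b w φ x ≤ ε * nnFormZ φ)
    (hP : ∀ E₀ : Cell 2 × ℤ, E₀.2 = 0 → (idxNorm E₀ : ℝ) ≤ 1 → ∀ (y₀ : Cell 2 × ℤ) (r' n' : ℝ), r' < n' → ∀ χ : Cell 2 → ℤ → E3,
      IsTruncHarmonicZ ϱ a b w χ (idxBall y₀ (n' + 1)) →
        κ₀ * idxEnergy (latDiff E₀ χ) (idxBall y₀ r') ≤ 54 * kernelConst c * ((n' - r')⁻¹) ^ 2 * idxEnergy χ (idxBall y₀ (n' + ϱ / c + 1)))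
    (x₀ : Cell 2 × ℤ) {n : ℝ} (hn : 512 * (ϱ / c + 2) ≤ n) {φ : Cell 2 → ℤ → E3} (hφ : IsTruncHarmonicZ ϱ a b w φ (idxBall x₀ n))
    {T : Finset ℤ} {m : ℤ} (hTm : Icc (m - ⌊ϱ / c⌋₊) (m + 1 + ⌊ϱ / c⌋₊) ⊆ T) (hm : |((m - x₀.2 : ℤ) : ℝ)| + 2 * (⌊ϱ / c⌋₊ : ℝ) ≤ n / 2) :
    ‖colPlanar ϱ a b w T φ x₀.1 m - boxSlope ϱ a b w ⌊ϱ / c⌋₊ (slopeAt φ x₀) m‖ ≤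
      216 * kernelConst c * Real.sqrt (864 * ipConst c κ₀ ε * idxEnergy φ (idxBall x₀ n) / (n ^ 2 * ((idxBall x₀ n).ncard : ℝ))) *
        (|((m - x₀.2 : ℤ) : ℝ)| + 1) := by
  rw [colPlanar_sub_boxSlope hc hL φ x₀ hTm]
  exact norm_colPlanar_drift_le hc hL hκ₀ hϱ hε hK hT hP x₀ hn hφ T hm

/-! ### WQ.4  The closed statement of this part -/

/-- The content of part WQ as one closed proposition: the offset-weighted column planar flux bound and the ϱ-free slope-mismatch estimate on the
central column. -/
def SlopeMismatchShape : Prop :=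
  ∀ c : ℝ, 0 < c → ∀ (a b : E3) (w : ℤ → E3), IsLayeredCrystal c a b w → ∀ (ϱ : ℝ),
    (∀ (ψ : Cell 2 → ℤ → E3) (T : Finset ℤ) (γ : Cell 2) (m : ℤ) (G₀ G₁ : ℝ), 0 ≤ G₀ → 0 ≤ G₁ →
      (∀ (p : Cell 2) (β : ℤ) (M : ℕ), (∀ j, |p j - γ j| ≤ (M : ℤ)) → m < β → β ≤ m + M → M ≤ ⌊ϱ / c⌋₊ →
        ‖latDiff idxAxis₁ ψ p β‖ ≤ G₀ + G₁ * M ∧ ‖latDiff idxAxis₂ ψ p β‖ ≤ G₀ + G₁ * M) →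
      ‖colPlanar ϱ a b w T ψ γ m‖ ≤ 108 * kernelConst c * (G₀ + G₁)) ∧
    ∀ κ₀ ε : ℝ, 0 < κ₀ → 0 ≤ ϱ → ε < 2 * κ₀ → CoerciveZ (layeredKernel a b w) κ₀ →
      (∀ φ : Cell 2 → ℤ → E3, HasFiniteSupport φ → Summable (tailFam ϱ a b w φ) ∧ ∑' x, tailFam ϱ a b w φ x ≤ ε * nnFormZ φ) →
      (∀ E₀ : Cell 2 × ℤ, E₀.2 = 0 → (idxNorm E₀ : ℝ) ≤ 1 → ∀ (y₀ : Cell 2 × ℤ) (r' n' : ℝ), r' < n' → ∀ χ : Cell 2 → ℤ → E3,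
        IsTruncHarmonicZ ϱ a b w χ (idxBall y₀ (n' + 1)) →
          κ₀ * idxEnergy (latDiff E₀ χ) (idxBall y₀ r') ≤ 54 * kernelConst c * ((n' - r')⁻¹) ^ 2 * idxEnergy χ (idxBall y₀ (n' + ϱ / c + 1))) →
      ∀ (x₀ : Cell 2 × ℤ) (n : ℝ), 512 * (ϱ / c + 2) ≤ n → ∀ φ : Cell 2 → ℤ → E3, IsTruncHarmonicZ ϱ a b w φ (idxBall x₀ n) →
        ∀ (T : Finset ℤ) (m : ℤ), Icc (m - ⌊ϱ / c⌋₊) (m + 1 + ⌊ϱ / c⌋₊) ⊆ T → |((m - x₀.2 : ℤ) : ℝ)| + 2 * (⌊ϱ / c⌋₊ : ℝ) ≤ n / 2 →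
          ‖colPlanar ϱ a b w T φ x₀.1 m - boxSlope ϱ a b w ⌊ϱ / c⌋₊ (slopeAt φ x₀) m‖ ≤
            216 * kernelConst c * Real.sqrt (864 * ipConst c κ₀ ε * idxEnergy φ (idxBall x₀ n) / (n ^ 2 * ((idxBall x₀ n).ncard : ℝ))) *
              (|((m - x₀.2 : ℤ) : ℝ)| + 1)

/-- WQ holds. [this file, g58] -/
theorem slopeMismatchShape_holds : SlopeMismatchShape :=
  fun _c hc _a _b _w hL _ϱ => ⟨fun ψ T γ m _G₀ _G₁ hG0 hG1 hG => norm_colPlanar_le_weighted hc hL ψ T γ m hG0 hG1 hG,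
    fun _κ₀ _ε hκ₀ hϱ hε hK hT hP x₀ _n hn _φ hφ _T _m hTm hm => norm_colPlanar_sub_boxSlope_le hc hL hκ₀ hϱ hε hK hT hP x₀ hn hφ hTm hm⟩

end SlopeMismatch

end Summit.AtomisticToContinuum.Crystallization.Theorems.ChartedZeroExcessLayeredLatticeLiouville
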